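import Literature.NumberTheory.LFunctions.ZetaKernelEvaluation
import Literature.NumberTheory.LFunctions.MertensCertificate
import HarnessLib

/-!
# A kernel-checkable Backlund certificate for `RiemannHypothesisUpTo T₀` (integer heights)

Trunk T-ANT (`NumberTheory/LFunctions`) with T-VALNUM. A second certificate format for the
Riemann hypothesis up to a given height, after `ZetaArgumentCertificate.lean`
(`Literature.NumberTheory.LFunctions.ZetaCert.RHCert`, order-two Euler–Maclaurin in the fixed-point
arithmetic at scale `2^48`, accepted for `T = 14, 16, 19`). The present format is built on the
kernel-evaluable multi-precision evaluator `Literature.NumberTheory.LFunctions.ZetaNumerics.zetaBoxK`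
(`ZetaKernelEvaluation.lean`: Euler–Maclaurin of any order `ν` with cut-off `N`, inclusion-monotone
in a *box* of `s`), which is what makes heights `T₀ ≈ 100` affordable for `decide +kernel`
(about two seconds per evaluation of `ζ` at `N = 28`, `ν = 12`, scale `2^60`); its first use is
`RiemannHypothesisUpTo 101` (`RiemannHypothesisUpTo101.lean`, 29 zeros), the numerical input of
Levinson–Montgomery's Theorem 1 in the range of Spira's table (`LevinsonMontgomeryTheoremProofs.lean`).

The method is Backlund's [Edwards1974, §6.6] in the exact-count form of the tree, exactly as in
the certified Odlyzko–te Riele computation (`MertensCertificate.lean`, whose top-edge checker and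
Stirling check are followed here line by line, with the height and the count as parameters):

1. **`N(T₀) = n` from the top edge alone** (`checkTop`): a list of pieces `[x_{k-1}, x_k]/2¹² × {T₀}`
   covering `[½, 2] × {T₀}` with labels `d_k : Fin 4`; on each piece ONE evaluation of `zetaBoxK`
   over the whole box certifies `Re((-i)^{d_k} ζ) > 0` there (`labelOk`), so the list is a valid
   `Literature.Analysis.Complex.HPieces` certificate (`WindingCertificate.lean`); with last label `0`
   and the Stirling inequality `|M(T₀)/π + 1 − turns/2 − n| + 2K(¼)/(πT₀) ≤ ½` checked in interval
   arithmetic (`checkStirling`), Backlund's formula gives `N(T₀) = n`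
   (`Literature.NumberTheory.LFunctions.MertensZeroCertificate.zetaZeroCount_eq_of_hpieces_stirling`).
2. **`N₀` from brackets** (`checkZeros`): pairs `a_j < b_j` (denominator `2⁸`, `b_j − a_j ≤ ⅛`,
   `b_j < a_{j+1}`) with `hi Re(ζ(½ + i a_j/2⁸) · conj ζ(½ + i b_j/2⁸)) < 0` each enclose a zero on
   the critical line (twisted sign test `Literature.NumberTheory.LFunctions.exists_zero_Icc_of_re_mul_conj_neg'`,
   no evaluation of `θ`), and separated brackets give distinct zeros
   (`Literature.NumberTheory.LFunctions.criticalZeroCount_add_card_le`): `N₀(h/2⁸) + #brackets ≤ N₀(b_last/2⁸)`,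
   chainable across files.
3. **Turing's reduction** `N(T₀) ≤ N₀(T₀) → RiemannHypothesisUpTo T₀`
   (`Literature.NumberTheory.DiophantineGeometry.RiemannHypothesisUpTo.of_zetaZeroCount_le_criticalZeroCount`),
   assembled in `riemannHypothesisUpTo_of_checkTop` / `riemannHypothesisUpTo_of_checks`.

Everything in this file is proved; it contains no certificate data (the data are literal
arguments of the `decide +kernel` theorems of the files using it) and no evaluation. Usage note:
keep each `decide +kernel` declaration to about a dozen evaluations of `ζ` (e.g. five or six
brackets); the bracket lists chain through the starting height `h` and `lastB`.

## Main definitions and results (namespace `Literature.NumberTheory.LFunctions.RHUpToCert`)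

* `S = 2^60`, `tablesWith N ν` (`mkTablesK`), `topBox`, `checkPieces`, `checkStirling`,
  `checkTop N ν T₀ n pieces` (the piece bookkeeping `labelOk`, `lastX`, `lastDirN`, `turnsN`,
  `toRealPieces` is that of `MertensCertificate.lean`); `lineBox`, `checkBracket`, `checkBrackets`,
  `lastB`, `checkZeros N ν h L`.
* `zetaZeroCount_of_checkTop : checkTop N ν T₀ n ps = true → N(T₀) = n`.
* `criticalZeroCount_of_checkZeros : checkZeros N ν h L = true → N₀(h/2⁸) + L.length ≤ N₀(lastB h L/2⁸)`.
* `riemannHypothesisUpTo_of_checkTop`, `riemannHypothesisUpTo_of_checks` — 1–3 assembled: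
  `RiemannHypothesisUpTo T₀`, `N(T₀) = n` and `N₀(T₀) = n` from an accepted top check and
  `N₀(0) + n ≤ N₀(T₀)`, resp. one accepted bracket list of length `n` below `T₀`.

## References

* H. M. Edwards, *Riemann's Zeta Function*, Academic Press 1974, §6.4 (Euler–Maclaurin), §6.6
  (Backlund's determination of `N(T)`). [Edwards1974]
* E. C. Titchmarsh, *The Theory of the Riemann Zeta-Function*, 2nd ed. 1986, Thm. 9.3. [Titchmarsh1986]
* R. P. Brent, *On the zeros of the Riemann zeta function in the critical strip*, Math. Comp. 33
  (1979), §3 (zeros on the line from sign changes). [Brent1979]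
-/

open Complex Literature.Analysis.ValidatedNumerics.NumericsMP Literature.NumberTheory.LFunctions.ZetaNumerics
open Literature.Analysis.Complex (HPieces qrot qturn piecesLast piecesLastDir piecesTurns)
open Literature.NumberTheory.LFunctions.ZetaNumerics.Mertens (labelOk toRealPieces lastX lastDirN turnsN
  piecesLast_toRealPieces piecesLastDir_toRealPieces piecesTurns_toRealPieces)
open scoped Real ComplexConjugate

namespace Literature.NumberTheory.LFunctions.RHUpToCert

/-! ## 1. Parameters -/

/-- Scale `2^60` of the interval arithmetic. [folklore] -/
def S : ℕ := 2 ^ 60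

/-- Tables with cut-off `N` and order `ν`: `π` and `log n` at scale `2^70` (`72` series terms,
Machin with `16` terms), `9` Taylor terms and `4` halvings for `exp` and `expI`. [folklore] -/
def tablesWith (N nu : ℕ) : Option Tables := mkTablesK S N nu 10 72 16 9 4 9 4

/-- Number of series terms for the logarithms of the Stirling check. [folklore] -/
def KST : ℕ := 64

/-- [folklore] -/
lemma S_pos : 0 < S := by unfold S; positivity

/-- `2¹² ∣ S`. [folklore] -/
lemma S_div : (S / 4096 : ℕ) * 4096 = S := by unfold S; norm_num

/-- Tables built by `tablesWith` are valid. [folklore] -/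
lemma tablesWith_valid {N nu : ℕ} {T : Tables} (h : tablesWith N nu = some T) : T.Valid :=
  mkTablesK_valid h

/-- Tables built by `tablesWith` have scale `S`. [folklore] -/
lemma tablesWith_S {N nu : ℕ} {T : Tables} (h : tablesWith N nu = some T) : T.S = S :=
  mkTablesK_S h

/-! ## 2. The top edge `[½, 2] × {T₀}` -/

/-- The box `[x₀, x₁]/2¹² × {T₀}` at scale `S`. [folklore] -/
def topBox (T0 x0 x1 : ℕ) : MC :=
  ⟨⟨(x0 : ℤ) * (S / 4096 : ℕ), (x1 : ℤ) * (S / 4096 : ℕ)⟩, MI.ofInt S T0⟩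

/-- Check of a piece list along the top edge from `x₀/2¹²`: one evaluation of `zetaBoxK` on each
box `[x_{k-1}, x_k]/2¹² × {T₀}`. [folklore] -/
def checkPieces (T : Tables) (T0 : ℕ) : ℕ → List (ℕ × Fin 4) → Bool
  | _, [] => true
  | x0, (x1, d) :: ps =>
    decide (x0 ≤ x1) &&
    (match zetaBoxK T (topBox T0 x0 x1) with
      | none => false
      | some Z => labelOk d Z) &&
    checkPieces T T0 x1 ps

/-- Enclosure check of the Stirling inequality
`|M(T₀)/π + 1 − turns/2 − n| + 2K(¼)/(πT₀) ≤ ½`, `M(T) = (T/2)log(T/2π) − T/2 − π/8`,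
`K(¼) = 1/6 + π/12 + 1/32 + 1/8`, at scale `S` (logarithms by `logNatK`, kernel-reducible).
[folklore] -/
def checkStirling (T : Tables) (T0 n : ℕ) (turns : ℤ) : Bool :=
  let piI := T.piI
  match logNatK S KST T0, MI.logTwo S KST, MI.divPos S (MI.ofInt S 3) piI with
  | some lT, some l2, some q =>
    -- log π = log 3 − log (1 − (1 − 3/π))
    match logNatK S KST 3, MI.logOneSub S KST ((MI.ofInt S 1).sub q) with
    | some l3, some lq =>
      let lpi := l3.sub lq
      let L := (lT.sub l2).sub lpi                                  -- log (T₀/2π)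
      let M := ((MI.mul S L (MI.ofFrac S T0 2)).sub (MI.ofFrac S T0 2)).sub (piI.divNat 8)
      match MI.divPos S M piI with
      | none => false
      | some Mpi =>
        let W := ((Mpi.add (MI.ofInt S 1)).sub (MI.ofFrac S turns 2)).sub (MI.ofInt S n)
        let K := ((MI.ofFrac S 1 6).add (MI.ofFrac S 5 32)).add (piI.divNat 12)
        match MI.divPos S (K.mulInt 2) (MI.mul S piI (MI.ofInt S T0)) with
        | none => false
        | some R => decide (2 * (W.absHi + R.hi) ≤ (S : ℤ))
    | _, _ => false
  | _, _, _ => false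

/-- Top-edge check with given tables: pieces from `2048/2¹² = ½` to `8192/2¹² = 2`, last label `0`,
and the Stirling inequality for the count `n`. [folklore] -/
def checkTopWith (T : Tables) (T0 n : ℕ) : List (ℕ × Fin 4) → Bool
  | [] => false
  | (x1, d1) :: ps =>
    checkPieces T T0 2048 ((x1, d1) :: ps) && decide (lastX x1 ps = 8192) &&
      decide (lastDirN d1 ps = 0) && checkStirling T T0 n (turnsN d1 ps)

/-- **The top-edge check** for the claim `N(T₀) = n` (`T₀ ≥ 2` an integer), with tables of cut-off
`N` and order `ν`. [folklore] -/
def checkTop (N nu T0 n : ℕ) (ps : List (ℕ × Fin 4)) : Bool :=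
  decide (2 ≤ T0) &&
    match tablesWith N nu with
    | none => false
    | some T => checkTopWith T T0 n ps

/-! ## 3. Brackets on the critical line -/

/-- The point box `{½ + i a/2⁸}`. [folklore] -/
def lineBox (a : ℕ) : MC := ⟨MI.ofFrac S 1 2, MI.ofFrac S a 256⟩

/-- **The bracket check**: `1 ≤ a/2⁸ ≤ b/2⁸ ≤ 2²⁰`, `b − a ≤ 2⁸/8`, and the twisted sign test
`hi Re(ζ(½ + ia/2⁸) · conj ζ(½ + ib/2⁸)) < 0` from two evaluations of `zetaBoxK`. [folklore] -/
def checkBracket (T : Tables) (a b : ℕ) : Bool :=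
  decide (256 ≤ a) && decide (a ≤ b) && decide (b ≤ a + 32) && decide (b ≤ 2 ^ 28) &&
    match zetaBoxK T (lineBox a), zetaBoxK T (lineBox b) with
    | some Z1, some Z2 => decide (((Z1.re.mul S Z2.re).add (Z1.im.mul S Z2.im)).hi < 0)
    | _, _ => false

/-- Check of a list of brackets above height `h/2⁸`, in increasing order and separated.
[folklore] -/
def checkBrackets (T : Tables) : ℕ → List (ℕ × ℕ) → Bool
  | _, [] => true
  | h, (a, b) :: L => decide (h < a) && checkBracket T a b && checkBrackets T b L

/-- The upper endpoint of the last bracket (or `h` for the empty list). [folklore] -/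
def lastB (h : ℕ) : List (ℕ × ℕ) → ℕ
  | [] => h
  | (_, b) :: L => lastB b L

/-- **The bracket-list check** with tables of cut-off `N` and order `ν`, starting above height
`h/2⁸`. [folklore] -/
def checkZeros (N nu h : ℕ) (L : List (ℕ × ℕ)) : Bool :=
  match tablesWith N nu with
  | none => false
  | some T => checkBrackets T h L

/-! ## 4. Soundness of the top-edge check -/

section Top

/-- Soundness of `labelOk` (the label test of `MertensCertificate.lean`), at any scale `Sc`.
[folklore] -/
lemma labelOk_sound {Sc : ℕ} {d : Fin 4} {Z : MC} (h : labelOk d Z = true) {z : ℂ}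
    (hz : MC.mem Sc z Z) : 0 < (qrot d * z).re := by
  fin_cases d
  · have hlt : 0 < Z.re.lo := of_decide_eq_true h
    have := MI.pos_of_lo_pos hz.1 hlt
    simpa [qrot] using this
  · have hlt : 0 < Z.im.lo := of_decide_eq_true h
    have := MI.pos_of_lo_pos hz.2 hlt
    simpa [qrot] using this
  · have hlt : Z.re.hi < 0 := of_decide_eq_true h
    have := MI.neg_of_hi_neg hz.1 hlt
    simp [qrot]; linarith
  · have hlt : Z.im.hi < 0 := of_decide_eq_true h
    have := MI.neg_of_hi_neg hz.2 hlt
    simp [qrot]; linarith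

/-- Membership of `x + iT₀` in `topBox T₀ x₀ x₁` for `x₀/2¹² ≤ x ≤ x₁/2¹²`. [folklore] -/
lemma mem_topBox {T0 x0 x1 : ℕ} {x : ℝ} (hx : x ∈ Set.Icc ((x0 : ℝ) / 4096) ((x1 : ℝ) / 4096)) :
    MC.mem S ((x : ℂ) + (T0 : ℝ) * I) (topBox T0 x0 x1) := by
  have hq : ((S / 4096 : ℕ) : ℝ) * 4096 = S := by
    rw [show (4096 : ℝ) = ((4096 : ℕ) : ℝ) by norm_num, ← Nat.cast_mul, S_div]
  constructor
  · simp only [topBox, Complex.add_re, Complex.ofReal_re, Complex.mul_re, Complex.I_re,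
      Complex.I_im, Complex.ofReal_im, mul_zero, zero_mul, sub_zero, add_zero]
    obtain ⟨h1, h2⟩ := hx
    rw [div_le_iff₀ (by norm_num)] at h1
    rw [le_div_iff₀ (by norm_num)] at h2
    have hp : (0 : ℝ) ≤ ((S / 4096 : ℕ) : ℝ) := by positivity
    constructor
    · simp only [Int.cast_mul, Int.cast_natCast]
      calc (x0 : ℝ) * ((S / 4096 : ℕ) : ℝ) ≤ x * 4096 * ((S / 4096 : ℕ) : ℝ) :=
            mul_le_mul_of_nonneg_right h1 hp
        _ = x * S := by rw [← hq]; ring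
    · simp only [Int.cast_mul, Int.cast_natCast]
      calc x * (S : ℝ) = x * 4096 * ((S / 4096 : ℕ) : ℝ) := by rw [← hq]; ring
        _ ≤ (x1 : ℝ) * ((S / 4096 : ℕ) : ℝ) := mul_le_mul_of_nonneg_right h2 hp
  · simp only [topBox, Complex.add_im, Complex.ofReal_im, Complex.mul_im, Complex.I_re,
      Complex.I_im, Complex.ofReal_re, mul_zero, mul_one, zero_add, add_zero]
    exact_mod_cast MI.mem_ofInt S (T0 : ℤ)

/-- Soundness of `checkPieces`: a valid `HPieces` certificate for `ζ` at height `T₀ ≠ 0`.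
[cite: Edwards1974, §6.6] -/
theorem hpieces_of_checkPieces {T : Tables} (hT : T.Valid) (hTS : T.S = S) {T0 : ℕ} (hT0 : T0 ≠ 0) :
    ∀ (x0 : ℕ) (ps : List (ℕ × Fin 4)), checkPieces T T0 x0 ps = true →
      HPieces riemannZeta (T0 : ℝ) ((x0 : ℝ) / 4096) (toRealPieces ps)
  | x0, [], _ => trivial
  | x0, (x1, d) :: ps, h => by
    simp only [checkPieces, Bool.and_eq_true, decide_eq_true_eq] at h
    obtain ⟨⟨h01, hmid⟩, htail⟩ := h
    simp only [toRealPieces]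
    refine ⟨by exact_mod_cast (div_le_div_of_nonneg_right (by exact_mod_cast h01) (by norm_num)), ?_,
      hpieces_of_checkPieces hT hTS hT0 x1 ps htail⟩
    intro x hx
    split at hmid
    · simp at hmid
    · rename_i Z hZ
      have hs : MC.mem T.S ((x : ℂ) + (T0 : ℝ) * I) (topBox T0 x0 x1) := hTS ▸ mem_topBox hx
      have hs1 : (x : ℂ) + (T0 : ℝ) * I ≠ 1 := fun h ↦ by
        have := congrArg Complex.im h
        simp at this
        exact hT0 (by exact_mod_cast this)
      have hm := mem_zetaBoxK hT hs hs1 hZ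
      rw [hTS] at hm
      exact labelOk_sound hmid hm

/-- Soundness of `checkStirling`: the hypothesis `hV` of
`Literature.NumberTheory.LFunctions.MertensZeroCertificate.zetaZeroCount_eq_of_hpieces_stirling`.
[cite: Titchmarsh1986, Thm. 9.3 and §4.17] -/
theorem stirling_of_checkStirling {T : Tables} (hT : T.Valid) (hTS : T.S = S) {T0 n : ℕ}
    (hT0 : T0 ≠ 0) {turns : ℤ} (h : checkStirling T T0 n turns = true) :
    |((T0 : ℝ) / 2 * Real.log (T0 / (2 * Real.pi)) - T0 / 2 - Real.pi / 8) / Real.pi + 1 -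
        (turns : ℝ) / 2 - (n : ℕ)| + 2 * stirlingVertRate (1 / 4) / (Real.pi * T0) ≤ 1 / 2 := by
  have hpi : MI.mem S Real.pi T.piI := hTS ▸ hT.mem_pi
  have hSr : (0 : ℝ) < S := by exact_mod_cast S_pos
  have hT0r : (0 : ℝ) < T0 := by exact_mod_cast Nat.pos_of_ne_zero hT0
  unfold checkStirling at h
  simp only at h
  split at h
  · rename_i lT l2 q hlT hl2 hq
    split at h
    · rename_i l3 lq hl3 hlq
      split at h
      · simp at h
      · rename_i Mpi hMpi
        split at h
        · simp at h
        · rename_i R hR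
          have hdec : 2 * ((((Mpi.add (MI.ofInt S 1)).sub (MI.ofFrac S turns 2)).sub
              (MI.ofInt S n)).absHi + R.hi) ≤ (S : ℤ) := of_decide_eq_true h
          -- the enclosures
          rw [logNatK_eq] at hlT hl3
          have hlogT := MI.mem_logNat S_pos hlT
          have hlog2 := MI.mem_logTwo S_pos hl2
          have hlog3 := MI.mem_logNat S_pos hl3
          have h3pi : MI.mem S ((3 : ℝ) / Real.pi) q := by
            have := MI.mem_divPos S_pos hq (MI.mem_ofInt S 3) hpi; simpa using this
          have hx : MI.mem S (1 - 3 / Real.pi) ((MI.ofInt S 1).sub q) := by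
            have := MI.mem_sub (MI.mem_ofInt S 1) h3pi; simpa using this
          have hlq' := MI.mem_logOneSub S_pos hlq hx
          have hpi0 : 0 < Real.pi := Real.pi_pos
          have elq : Real.log (1 - (1 - 3 / Real.pi)) = Real.log 3 - Real.log Real.pi := by
            rw [show (1 : ℝ) - (1 - 3 / Real.pi) = 3 / Real.pi by ring,
              Real.log_div (by norm_num) hpi0.ne']
          rw [elq] at hlq'
          have hlpi : MI.mem S (Real.log Real.pi) (l3.sub lq) := by
            have := MI.mem_sub hlog3 hlq'
            convert this using 1; push_cast; ring
          have hL : MI.mem S (Real.log (T0 / (2 * Real.pi))) ((lT.sub l2).sub (l3.sub lq)) := by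
            have := MI.mem_sub (MI.mem_sub hlogT hlog2) hlpi
            convert this using 1
            rw [Real.log_div hT0r.ne' (by positivity), Real.log_mul (by norm_num) hpi0.ne']
            ring
          have hT2 : MI.mem S ((T0 : ℝ) / 2) (MI.ofFrac S T0 2) := by
            have := MI.mem_ofFrac S (T0 : ℤ) (q := 2) (by norm_num)
            simpa using this
          set Mv : ℝ := (T0 : ℝ) / 2 * Real.log (T0 / (2 * Real.pi)) - T0 / 2 -
            Real.pi / 8 with hMv
          have hM : MI.mem S Mv (((MI.mul S ((lT.sub l2).sub (l3.sub lq)) (MI.ofFrac S T0 2)).sub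
              (MI.ofFrac S T0 2)).sub (T.piI.divNat 8)) := by
            have := MI.mem_sub (MI.mem_sub (MI.mem_mul S_pos hL hT2) hT2)
              (MI.mem_divNat hpi (n := 8) (by norm_num))
            convert this using 1
            rw [hMv]; push_cast; ring
          have hMpi' := MI.mem_divPos S_pos hMpi hM hpi
          set Wv : ℝ := Mv / Real.pi + 1 - (turns : ℝ) / 2 - (n : ℕ) with hWv
          have hW : MI.mem S Wv (((Mpi.add (MI.ofInt S 1)).sub (MI.ofFrac S turns 2)).sub
              (MI.ofInt S n)) := by
            have := MI.mem_sub (MI.mem_sub (MI.mem_add hMpi' (MI.mem_ofInt S 1))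
              (MI.mem_ofFrac S turns (q := 2) (by norm_num))) (MI.mem_ofInt S n)
            convert this using 1
            rw [hWv]; push_cast; ring
          have hK : MI.mem S (stirlingVertRate (1 / 4))
              (((MI.ofFrac S 1 6).add (MI.ofFrac S 5 32)).add (T.piI.divNat 12)) := by
            have := MI.mem_add (MI.mem_add (MI.mem_ofFrac S 1 (q := 6) (by norm_num))
              (MI.mem_ofFrac S 5 (q := 32) (by norm_num))) (MI.mem_divNat hpi (n := 12) (by norm_num))
            convert this using 1
            unfold stirlingVertRate; push_cast; ring
          have hRv : MI.mem S (2 * stirlingVertRate (1 / 4) / (Real.pi * T0)) R := by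
            have := MI.mem_divPos S_pos hR (MI.mem_mulInt hK 2)
              (MI.mem_mul S_pos hpi (MI.mem_ofInt S (T0 : ℤ)))
            convert this using 1; push_cast; ring
          -- read off the bound
          have h1 := MI.abs_le_absHi hW
          have h2 := hRv.2
          have hdec' : (2 : ℝ) * ((((Mpi.add (MI.ofInt S 1)).sub (MI.ofFrac S turns 2)).sub
              (MI.ofInt S n)).absHi + R.hi) ≤ S := by exact_mod_cast hdec
          have : (|Wv| + 2 * stirlingVertRate (1 / 4) / (Real.pi * T0)) * S ≤ S / 2 := by
            nlinarith
          have := le_of_mul_le_mul_right (by linarith : (|Wv| + 2 * stirlingVertRate (1 / 4) /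
            (Real.pi * T0)) * S ≤ 1 / 2 * S) hSr
          simpa [hWv, hMv] using this
    · simp at h
  · simp at h

/-- **The zero count from the top-edge check**: `checkTop N ν T₀ n ps = true → N(T₀) = n`.
[cite: Titchmarsh1986, Thm. 9.3] -/
theorem zetaZeroCount_of_checkTop {N nu T0 n : ℕ} {ps : List (ℕ × Fin 4)}
    (h : checkTop N nu T0 n ps = true) : zetaZeroCount (T0 : ℝ) = n := by
  unfold checkTop at h
  simp only [Bool.and_eq_true, decide_eq_true_eq] at h
  obtain ⟨hT2, h⟩ := h
  generalize hTab : tablesWith N nu = o at h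
  rcases o with _ | T
  · simp at h
  · simp only at h
    have hT : T.Valid := tablesWith_valid hTab
    have hTS : T.S = S := tablesWith_S hTab
    have hT0 : T0 ≠ 0 := by omega
    rcases ps with _ | ⟨⟨x1, d1⟩, ps⟩
    · simp [checkTopWith] at h
    simp only [checkTopWith, Bool.and_eq_true, decide_eq_true_eq] at h
    obtain ⟨⟨⟨hpieces, hlast⟩, hdir⟩, hstir⟩ := h
    have hP := hpieces_of_checkPieces hT hTS hT0 2048 ((x1, d1) :: ps) hpieces
    simp only [toRealPieces] at hP
    have h2048 : ((2048 : ℕ) : ℝ) / 4096 = 1 / 2 := by norm_num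
    rw [h2048] at hP
    have hlast' : piecesLast ((x1 : ℝ) / 4096) (toRealPieces ps) = 2 := by
      rw [piecesLast_toRealPieces, hlast]; norm_num
    have hdir' : piecesLastDir d1 (toRealPieces ps) = 0 := by
      rw [piecesLastDir_toRealPieces, hdir]
    have hS := stirling_of_checkStirling hT hTS hT0 hstir
    rw [← piecesTurns_toRealPieces] at hS
    exact MertensZeroCertificate.zetaZeroCount_eq_of_hpieces_stirling (by exact_mod_cast hT2) hP
      hlast' hdir' hS

end Top

/-! ## 5. Soundness of the bracket checks -/

section Zeros

/-- Membership of `½ + i a/2⁸` in `lineBox a`. [folklore] -/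
lemma mem_lineBox (a : ℕ) : MC.mem S (1 / 2 + (((a : ℝ) / 256 : ℝ) : ℂ) * I) (lineBox a) := by
  have ht : MI.mem S ((a : ℝ) / 256) (MI.ofFrac S a 256) := by
    have := MI.mem_ofFrac S (a : ℤ) (q := 256) (by norm_num)
    simpa using this
  refine ⟨?_, by simpa [lineBox] using ht⟩
  have := MI.mem_ofFrac S 1 (q := 2) two_pos
  simp only [lineBox, Complex.add_re, Complex.div_ofNat_re, Complex.one_re, Complex.mul_re,
    Complex.ofReal_re, Complex.I_re, Complex.ofReal_im, Complex.I_im, mul_zero, zero_mul, sub_zero,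
    add_zero]
  simpa using this

/-- **A checked bracket contains a zero of `ζ` on the critical line** (twisted sign test
`Literature.NumberTheory.LFunctions.exists_zero_Icc_of_re_mul_conj_neg'`), and
`1 ≤ a/2⁸ ≤ b/2⁸`. [cite: Brent1979, §3] -/
theorem exists_zero_of_checkBracket {T : Tables} (hT : T.Valid) (hTS : T.S = S) {a b : ℕ}
    (h : checkBracket T a b = true) :
    (1 : ℝ) ≤ (a : ℝ) / 256 ∧ (a : ℝ) / 256 ≤ (b : ℝ) / 256 ∧
      ∃ γ ∈ Set.Icc ((a : ℝ) / 256) ((b : ℝ) / 256), riemannZeta (1 / 2 + γ * I) = 0 := by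
  unfold checkBracket at h
  simp only [Bool.and_eq_true, decide_eq_true_eq] at h
  obtain ⟨⟨⟨⟨ha, hab⟩, hgap⟩, hb20⟩, hsign⟩ := h
  have ha' : (1 : ℝ) ≤ (a : ℝ) / 256 := by
    rw [le_div_iff₀ (by norm_num)]; exact_mod_cast ha
  have hab' : (a : ℝ) / 256 ≤ (b : ℝ) / 256 :=
    div_le_div_of_nonneg_right (by exact_mod_cast hab) (by norm_num)
  refine ⟨ha', hab', ?_⟩
  split at hsign
  · rename_i Z1 Z2 hZ1 hZ2
    have hlt : ((Z1.re.mul S Z2.re).add (Z1.im.mul S Z2.im)).hi < 0 := of_decide_eq_true hsign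
    have hne1 : ∀ t : ℝ, 1 ≤ t → (1 / 2 : ℂ) + t * I ≠ 1 := fun t ht h ↦ by
      have := congrArg Complex.im h; simp at this; linarith
    have hz1 : MC.mem S (riemannZeta (1 / 2 + (((a : ℝ) / 256 : ℝ) : ℂ) * I)) Z1 := by
      have hb : MC.mem T.S (1 / 2 + (((a : ℝ) / 256 : ℝ) : ℂ) * I) (lineBox a) := by
        rw [hTS]; exact mem_lineBox a
      have := mem_zetaBoxK hT hb (hne1 _ ha') hZ1
      rwa [hTS] at this
    have hz2 : MC.mem S (riemannZeta (1 / 2 + (((b : ℝ) / 256 : ℝ) : ℂ) * I)) Z2 := by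
      have hb : MC.mem T.S (1 / 2 + (((b : ℝ) / 256 : ℝ) : ℂ) * I) (lineBox b) := by
        rw [hTS]; exact mem_lineBox b
      have := mem_zetaBoxK hT hb (hne1 _ (ha'.trans hab')) hZ2
      rwa [hTS] at this
    set z1 := riemannZeta (1 / 2 + (((a : ℝ) / 256 : ℝ) : ℂ) * I) with hz1def
    set z2 := riemannZeta (1 / 2 + (((b : ℝ) / 256 : ℝ) : ℂ) * I) with hz2def
    have hre : (z1 * conj z2).re = z1.re * z2.re + z1.im * z2.im := by
      simp [Complex.mul_re, Complex.conj_re, Complex.conj_im]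
    have hmem : MI.mem S (z1 * conj z2).re ((Z1.re.mul S Z2.re).add (Z1.im.mul S Z2.im)) := by
      rw [hre]
      exact MI.mem_add (MI.mem_mul S_pos hz1.1 hz2.1) (MI.mem_mul S_pos hz1.2 hz2.2)
    have hneg : (z1 * conj z2).re < 0 := MI.neg_of_hi_neg hmem hlt
    have hb20' : (b : ℝ) / 256 ≤ 2 ^ 20 := by
      rw [div_le_iff₀ (by norm_num)]; exact_mod_cast hb20
    have hgap' : (b : ℝ) / 256 - (a : ℝ) / 256 ≤ 1 / 8 := by
      rw [← sub_div, div_le_iff₀ (by norm_num)]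
      have : ((b : ℝ) - a) ≤ 32 := by
        have := (Nat.cast_le (α := ℝ)).2 hgap; push_cast at this; linarith
      linarith
    exact exists_zero_Icc_of_re_mul_conj_neg' ha' hab' hb20' hgap' hneg
  · simp at hsign

/-- **Separated checked brackets give at least as many zeros on the critical line**:
`N₀(h/2⁸) + #brackets ≤ N₀(b_last/2⁸)`. [cite: Brent1979, §3] -/
theorem criticalZeroCount_of_checkBrackets {T : Tables} (hT : T.Valid) (hTS : T.S = S) :
    ∀ (h : ℕ) (L : List (ℕ × ℕ)), checkBrackets T h L = true →
      criticalZeroCount ((h : ℝ) / 256) + L.length ≤ criticalZeroCount ((lastB h L : ℝ) / 256)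
  | h, [], _ => by simp [lastB]
  | h, (a, b) :: L, hok => by
    simp only [checkBrackets, Bool.and_eq_true, decide_eq_true_eq] at hok
    obtain ⟨⟨hha, hB⟩, hrest⟩ := hok
    obtain ⟨ha1, hab, γ, hγ, hz⟩ := exists_zero_of_checkBracket hT hTS hB
    have h0 : (0 : ℝ) ≤ (h : ℝ) / 256 := by positivity
    have hha' : (h : ℝ) / 256 < (a : ℝ) / 256 :=
      div_lt_div_of_pos_right (by exact_mod_cast hha) (by norm_num)
    have h1 : criticalZeroCount ((h : ℝ) / 256) + 1 ≤ criticalZeroCount ((b : ℝ) / 256) := by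
      have := criticalZeroCount_add_card_le (a := (h : ℝ) / 256) (b := (b : ℝ) / 256)
        h0 (by linarith) {γ}
        (fun x hx ↦ by
          rw [Finset.mem_singleton] at hx; subst hx
          exact ⟨hz, lt_of_lt_of_le hha' hγ.1, hγ.2⟩)
      simpa using this
    have h2 := criticalZeroCount_of_checkBrackets hT hTS b L hrest
    simp only [List.length_cons, lastB]
    omega

/-- Soundness of `checkZeros`: `N₀(h/2⁸) + #brackets ≤ N₀(b_last/2⁸)`. [cite: Brent1979, §3] -/
theorem criticalZeroCount_of_checkZeros {N nu h : ℕ} {L : List (ℕ × ℕ)}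
    (hc : checkZeros N nu h L = true) :
    criticalZeroCount ((h : ℝ) / 256) + L.length ≤ criticalZeroCount ((lastB h L : ℝ) / 256) := by
  unfold checkZeros at hc
  generalize hTab : tablesWith N nu = o at hc
  rcases o with _ | T
  · simp at hc
  · simp only at hc
    exact criticalZeroCount_of_checkBrackets (tablesWith_valid hTab) (tablesWith_S hTab) h L hc

end Zeros

/-! ## 6. Assembly -/

/-- **RH up to `T₀` from the top-edge check and enough zeros on the line.** If the top-edge
check certifies `N(T₀) = n` and `N₀(0) + n ≤ N₀(T₀)` (e.g. from chained bracket lists,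
`criticalZeroCount_of_checkZeros` and `Literature.NumberTheory.LFunctions.criticalZeroCount_mono`), then `RiemannHypothesisUpTo T₀`,
`N(T₀) = n` and `N₀(T₀) = n` (Turing's reduction
`Literature.NumberTheory.DiophantineGeometry.RiemannHypothesisUpTo.of_zetaZeroCount_le_criticalZeroCount`).
[cite: Edwards1974, §6.6] -/
theorem riemannHypothesisUpTo_of_checkTop {N nu T0 n : ℕ} {ps : List (ℕ × Fin 4)}
    (h1 : checkTop N nu T0 n ps = true) (h2 : criticalZeroCount 0 + n ≤ criticalZeroCount (T0 : ℝ)) :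
    DiophantineGeometry.RiemannHypothesisUpTo (T0 : ℝ) ∧ zetaZeroCount (T0 : ℝ) = n ∧
      criticalZeroCount (T0 : ℝ) = n := by
  have hN := zetaZeroCount_of_checkTop h1
  have hle : zetaZeroCount (T0 : ℝ) ≤ criticalZeroCount (T0 : ℝ) := by omega
  have hRH := DiophantineGeometry.RiemannHypothesisUpTo.of_zetaZeroCount_le_criticalZeroCount hle
  refine ⟨hRH, hN, ?_⟩
  have := (DiophantineGeometry.riemannHypothesisUpTo_iff_criticalZeroCount_eq (T0 : ℝ)).1 hRH
  omega

/-- The same from ONE accepted bracket list of length `n` starting above height `0` and ending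
below `T₀`. [cite: Edwards1974, §6.6] -/
theorem riemannHypothesisUpTo_of_checks {N nu N' nu' T0 n : ℕ} {ps : List (ℕ × Fin 4)}
    {L : List (ℕ × ℕ)} (h1 : checkTop N nu T0 n ps = true) (h2 : checkZeros N' nu' 0 L = true)
    (hlen : L.length = n) (hlast : lastB 0 L ≤ 256 * T0) :
    DiophantineGeometry.RiemannHypothesisUpTo (T0 : ℝ) ∧ zetaZeroCount (T0 : ℝ) = n ∧
      criticalZeroCount (T0 : ℝ) = n := by
  refine riemannHypothesisUpTo_of_checkTop h1 ?_
  have hN0 := criticalZeroCount_of_checkZeros h2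
  rw [hlen] at hN0
  simp only [CharP.cast_eq_zero, zero_div] at hN0
  have hmono : criticalZeroCount ((lastB 0 L : ℝ) / 256) ≤ criticalZeroCount (T0 : ℝ) :=
    criticalZeroCount_mono
      (by rw [div_le_iff₀ (by norm_num)]; exact_mod_cast (show lastB 0 L ≤ T0 * 256 by omega))
  omega

end Literature.NumberTheory.LFunctions.RHUpToCert
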